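import Mathlib
import Summits.ValiantsHypothesis.ValiantsHypothesis.Theorems.RigidityForcesSymmetryRankRigidMinimalReprLaplaceFiveSeparatedCaptureTwoTerm
import Summits.ValiantsHypothesis.ValiantsHypothesis.Theorems.RigidityForcesSymmetryRankRigidMinimalReprLaplaceFiveSeparatedCaptureTwoK2Hub

/-!
# ValiantsHypothesis / RigidityForcesSymmetry — crux `LaplaceOptimalFive` (stmt-ValiantsHypothesis-24813), symmetric capture:
# **THE EQUAL-LINES CASE OF `CaptureIneqSym` IS A THEOREM** (`U₀₁ = U₀₂ = U₁₂ = ℂ·u` ⇒ `dim W ≤ 3`)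

The first unconditional slice of the `Ω ≠ 0` part of the symmetric capture inequality (memo
`pub/val-lit/lmr/NOTE-p4g17-24813-K32-symmetric-capture.md` §10), and the slice that contains the TIGHT configurations: the three
triangle spans are one and the same line `ℂ·u` (`u` a symmetric letter matrix).  Example: `u` = the indicator of the letter pair
`{0,1}` captures exactly the three obligations `x₀x₁x₂, x₀x₁x₃, x₀x₁x₄` (`dim W = 3`, the Laplace atom); a `u` with a diagonal entry or
with ≥ 3 letters captures less; a rank-one `u = κ·d dᵀ` captures nothing beyond the symmetric placement.

* `equalLines_h23`, `equalLines_h12` — the two agreement identities read off the slot symmetries of the obligation.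
* `cone_vanish` — if `u = κ·d dᵀ` and the placed tensor `κ(d⊗d⊗a + d⊗d⊗(a − s d) + (a − t d)⊗d⊗d)` vanishes at every `(r₀, r₀, r)`
  with `d r₀ ≠ 0`, then it vanishes identically.
* ★ `equalLines_structure` — PER-OBLIGATION STRUCTURE: if `T(p,q,r) = u(p,q)a_r + u(p,r)b_q + u(q,r)c_p` (u symmetric) is symmetric and
  vanishes at repeated letters, then `T` is the symmetric placement of `u ⊗ a′` for an `a′` vanishing on every LETTER of `u`
  (`u p q ≠ 0 ⇒ a′ p = 0`); when `a ≠ b` or `b ≠ c` the matrix `u` is a multiple of `d dᵀ` (✓ `rankOne_of_tensor_symm`,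
  ✓ `twoTerm_parallel`) and `T = 0` (`cone_vanish`).
* `contractZ_eq_zero_of_structure` — the obligation vanishes with `a′` (✓ `hub_injective`).
* ★ `finrank_le_three_of_equalLines` — for a space `W` of symmetric zero-diagonal leaf matrices whose obligations are all of that
  form: `finrank W ≤ 3` (two distinct letters `i ≠ j` of `u` kill two coordinates of `a′`, and `μ ↦ (T_μ(i,i′,k))_{k ∉ {i,j}}` is
  injective; a one-letter `u = κ·E_{ii}` or `u = 0` gives `W = 0`).

Honest framing.  One sub-case of an OPEN inequality (`CaptureIneqSym`); closes nothing; K1 on `K₃ ⊔ K₂`, S2′, `LaplaceOptimalFive`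
(OPEN · CONTESTED 72/120), `VP ≠ VNP` are NOT proved.  No definitions, no `sorry`; Mathlib + tree only.
-/

set_option linter.dupNamespace false
set_option autoImplicit false

namespace Summit.ValiantsHypothesis.ValiantsHypothesis.Theorems.RigidityForcesSymmetryRankRigidMinimalRepr

namespace LaplaceFiveSeparatedCapture

open Finset LaplaceFiveSectorSplit

section structure_lemmas

variable (u : Fin 5 → Fin 5 → ℂ) (T : Fin 5 → Fin 5 → Fin 5 → ℂ) (a b c : Fin 5 → ℂ)

/-- Agreement identity from the `(1 2)`-slot symmetry: `u ⊗ (a − b)` is symmetric in its last two slots. [folklore] -/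
theorem equalLines_h23 (hu : ∀ p q, u p q = u q p)
    (hT : ∀ p q r, T p q r = u p q * a r + u p r * b q + u q r * c p) (h23 : ∀ p q r, T p q r = T p r q)
    (p q r : Fin 5) : u p q * (a r - b r) = u p r * (a q - b q) := by
  have h := h23 p q r
  rw [hT, hT, hu r q] at h
  linear_combination h

/-- Agreement identity from the `(0 1)`-slot symmetry: `u ⊗ (b − c)` is symmetric in its last two slots. [folklore] -/
theorem equalLines_h12 (hu : ∀ p q, u p q = u q p)
    (hT : ∀ p q r, T p q r = u p q * a r + u p r * b q + u q r * c p) (h12 : ∀ p q r, T p q r = T q p r)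
    (p q r : Fin 5) : u p q * (b r - c r) = u p r * (b q - c q) := by
  have h := h12 q r p
  rw [hT, hT, hu q r, hu r q, hu q p, hu r p] at h
  linear_combination h

end structure_lemmas

/-- CONE LEMMA: with `u = κ·d dᵀ`, the placed tensor `κ(d_p d_q a_r + d_p d_r (a_q − s d_q) + d_q d_r (a_p − t d_p))` that vanishes
at all words `(r₀, r₀, r)` with `d r₀ ≠ 0` vanishes identically. [folklore] -/
theorem cone_vanish (κ s t : ℂ) (d a : Fin 5 → ℂ) (T : Fin 5 → Fin 5 → Fin 5 → ℂ)
    (hT : ∀ p q r, T p q r = κ * (d p * d q * a r + d p * d r * (a q - s * d q) + d q * d r * (a p - t * d p)))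
    (r₀ : Fin 5) (hd : d r₀ ≠ 0) (hrep : ∀ r, T r₀ r₀ r = 0) (p q r : Fin 5) : T p q r = 0 := by
  by_cases hκ : κ = 0
  · rw [hT, hκ, zero_mul]
  have h0 := hrep r₀
  rw [hT] at h0
  have h1 : 3 * a r₀ - (s + t) * d r₀ = 0 := by
    have : κ * d r₀ ^ 2 * (3 * a r₀ - (s + t) * d r₀) = 0 := by linear_combination h0
    rcases mul_eq_zero.mp this with h | h
    · rcases mul_eq_zero.mp h with h' | h'
      · exact absurd h' hκ
      · exact absurd ((pow_eq_zero_iff two_ne_zero).mp h') hd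
    · exact h
  have h2 : ∀ x, d r₀ * a x - d x * a r₀ = 0 := by
    intro x
    have hx := hrep x
    rw [hT] at hx
    have : κ * d r₀ * (d r₀ * a x - d x * a r₀) = 0 := by linear_combination hx - κ * d r₀ * d x * h1
    rcases mul_eq_zero.mp this with h | h
    · rcases mul_eq_zero.mp h with h' | h'
      · exact absurd h' hκ
      · exact absurd h' hd
    · exact h
  have h3 : d r₀ * T p q r = 0 := by
    rw [hT]
    linear_combination κ * d p * d q * d r * h1 + κ * d p * d q * h2 r + κ * d p * d r * h2 q + κ * d q * d r * h2 p
  rcases mul_eq_zero.mp h3 with h | h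
  · exact absurd h hd
  · exact h

/-- ★ PER-OBLIGATION STRUCTURE in the equal-lines case.  If `T(p,q,r) = u(p,q)a_r + u(p,r)b_q + u(q,r)c_p` (u symmetric) is symmetric
and vanishes at words with a repeated letter, then `T` is the symmetric placement of `u ⊗ a′` with `a′` vanishing on the letters of
`u`. [folklore] -/
theorem equalLines_structure (u : Fin 5 → Fin 5 → ℂ) (hu : ∀ p q, u p q = u q p)
    (T : Fin 5 → Fin 5 → Fin 5 → ℂ) (a b c : Fin 5 → ℂ)
    (hT : ∀ p q r, T p q r = u p q * a r + u p r * b q + u q r * c p)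
    (h12 : ∀ p q r, T p q r = T q p r) (h23 : ∀ p q r, T p q r = T p r q) (hrep : ∀ p r, T p p r = 0) :
    ∃ a' : Fin 5 → ℂ, (∀ p q r, T p q r = u p q * a' r + u p r * a' q + u q r * a' p) ∧
      (∀ p q, u p q ≠ 0 → a' p = 0) := by
  have hA := equalLines_h23 u T a b c hu hT h23
  have hB := equalLines_h12 u T a b c hu hT h12
  by_cases hab : ∀ r, a r = b r
  · by_cases hbc : ∀ r, b r = c r
    · -- a = b = c : T is the placement of u ⊗ a
      refine ⟨a, fun p q r => ?_, fun p q hupq => ?_⟩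
      · rw [hT, ← hab q, ← hbc p, ← hab p]
      · have hp := hrep p p
        rw [hT, ← hbc p, ← hab p] at hp
        by_cases hupp : u p p = 0
        · have hpq := hrep p q
          rw [hT, ← hbc p, ← hab p, hupp] at hpq
          have : 2 * u p q * a p = 0 := by linear_combination hpq
          rcases mul_eq_zero.mp this with h | h
          · rcases mul_eq_zero.mp h with h' | h'
            · norm_num at h'
            · exact absurd h' hupq
          · exact h
        · have : 3 * u p p * a p = 0 := by linear_combination hp
          rcases mul_eq_zero.mp this with h | h
          · rcases mul_eq_zero.mp h with h' | h'
            · norm_num at h'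
            · exact absurd h' hupp
          · exact h
    · -- a = b, b ≠ c : u is a multiple of d dᵀ, d = b - c, and T = 0
      push Not at hbc
      obtain ⟨r₀, hr₀⟩ := hbc
      let d : Fin 5 → ℂ := fun r => b r - c r
      have hd : d r₀ ≠ 0 := sub_ne_zero.mpr hr₀
      have hBd : ∀ p q r, u p q * d r = u p r * d q := fun p q r => hB p q r
      have hrank := rankOne_of_tensor_symm u d hu hBd r₀ hd
      refine ⟨0, fun p q r => ?_, fun p q _ => rfl⟩
      simp only [Pi.zero_apply, mul_zero, add_zero]
      refine cone_vanish (u r₀ r₀ / d r₀ ^ 2) 0 1 d a T (fun p q r => ?_) r₀ hd (fun r => hrep r₀ r) p q r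
      have hc : c p = a p - 1 * d p := by show c p = a p - 1 * (b p - c p); rw [← hab p]; ring
      rw [hT, hrank p q, hrank p r, hrank q r, ← hab q, hc]
      ring
  · -- a ≠ b : u is a multiple of d dᵀ, d = a - b, and b - c ∥ d; T = 0
    push Not at hab
    obtain ⟨r₀, hr₀⟩ := hab
    let d : Fin 5 → ℂ := fun r => a r - b r
    have hd : d r₀ ≠ 0 := sub_ne_zero.mpr hr₀
    have hAd : ∀ p q r, u p q * d r = u p r * d q := fun p q r => hA p q r
    have hrank := rankOne_of_tensor_symm u d hu hAd r₀ hd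
    refine ⟨0, fun p q r => ?_, fun p q _ => rfl⟩
    simp only [Pi.zero_apply, mul_zero, add_zero]
    by_cases hκ0 : u r₀ r₀ / d r₀ ^ 2 = 0
    · rw [hT, hrank p q, hrank p r, hrank q r, hκ0]; ring
    have hpar : ∀ x y, d x * (b y - c y) = d y * (b x - c x) := by
      intro x y
      have h := hB r₀ x y
      rw [hrank r₀ x, hrank r₀ y] at h
      have : u r₀ r₀ / d r₀ ^ 2 * d r₀ * (d x * (b y - c y) - d y * (b x - c x)) = 0 := by
        linear_combination h
      rcases mul_eq_zero.mp this with h' | h'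
      · rcases mul_eq_zero.mp h' with h'' | h''
        · exact absurd h'' hκ0
        · exact absurd h'' hd
      · exact sub_eq_zero.mp h'
    have hτ := twoTerm_parallel d (fun r => b r - c r) hpar r₀ hd
    have hτx : ∀ x, b x - c x = (b r₀ - c r₀) / d r₀ * d x := fun x => by
      have := congr_fun hτ x; simpa [Pi.smul_apply, smul_eq_mul] using this
    refine cone_vanish (u r₀ r₀ / d r₀ ^ 2) 1 (1 + (b r₀ - c r₀) / d r₀) d a T (fun p q r => ?_) r₀ hd
      (fun r => hrep r₀ r) p q r
    have hb : ∀ x, b x = a x - 1 * d x := fun x => by show b x = a x - 1 * (a x - b x); ring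
    have hc : ∀ x, c x = a x - (1 + (b r₀ - c r₀) / d r₀) * d x := by
      intro x
      have e : c x = b x - (b x - c x) := by ring
      rw [e, hτx x, hb x]; ring
    rw [hT, hrank p q, hrank p r, hrank q r, hb q, hc p]
    ring

/-- The obligation of `μ` vanishes identically once its symmetric-placement vector `a′` vanishes. [folklore] -/
theorem contractZ_eq_zero_of_structure (u : Fin 5 → Fin 5 → ℂ) (μ : Fin 5 → Fin 5 → ℂ) (a' : Fin 5 → ℂ)
    (hT : ∀ p q r, contractZ μ p q r = u p q * a' r + u p r * a' q + u q r * a' p) (ha : ∀ r, a' r = 0)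
    (hs : ∀ s t, μ s t = μ t s) (hd : ∀ s, μ s s = 0) : μ = 0 := by
  refine hub_injective μ hs hd fun p q => ?_
  refine Finset.sum_eq_zero fun r _ => ?_
  rw [hT, ha r, ha q, ha p]; ring

/-- ★ **THE EQUAL-LINES CASE OF THE SYMMETRIC CAPTURE INEQUALITY.**  Let `u` be a symmetric letter matrix and `W` a space of
symmetric zero-diagonal leaf matrices such that every obligation `contractZ μ` (`μ ∈ W`) has the form
`u(p,q)a_r + u(p,r)b_q + u(q,r)c_p` (i.e. is captured by the three equal spans `U₀₁ = U₀₂ = U₁₂ = ℂ·u`).  Then `finrank W ≤ 3`. [folklore] -/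
theorem finrank_le_three_of_equalLines (u : Fin 5 → Fin 5 → ℂ) (hu : ∀ p q, u p q = u q p)
    (W : Submodule ℂ (Fin 5 → Fin 5 → ℂ))
    (hWs : ∀ μ ∈ W, ∀ s t : Fin 5, μ s t = μ t s) (hWd : ∀ μ ∈ W, ∀ s : Fin 5, μ s s = 0)
    (hWc : ∀ μ ∈ W, ∃ a b c : Fin 5 → ℂ, ∀ p q r, contractZ μ p q r = u p q * a r + u p r * b q + u q r * c p) :
    Module.finrank ℂ W ≤ 3 := by
  classical
  have hstruct : ∀ μ ∈ W, ∃ a' : Fin 5 → ℂ,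
      (∀ p q r, contractZ μ p q r = u p q * a' r + u p r * a' q + u q r * a' p) ∧ (∀ p q, u p q ≠ 0 → a' p = 0) := by
    intro μ hμ
    obtain ⟨a, b, c, habc⟩ := hWc μ hμ
    exact equalLines_structure u hu (contractZ μ) a b c habc (fun p q r => (contractZ_swap12 μ p q r).symm)
      (fun p q r => (contractZ_swap23 μ p q r).symm) (fun p r => contractZ_rep12 μ p r)
  have hbot : (∀ μ ∈ W, μ = 0) → Module.finrank ℂ W ≤ 3 := by
    intro h
    have : W = ⊥ := (Submodule.eq_bot_iff W).mpr h
    rw [this, finrank_bot]; exact Nat.zero_le _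
  by_cases htwo : ∃ i i' j j' : Fin 5, i ≠ j ∧ u i i' ≠ 0 ∧ u j j' ≠ 0
  · obtain ⟨i, i', j, j', hij, hui, huj⟩ := htwo
    let K := {k : Fin 5 // k ≠ i ∧ k ≠ j}
    let Ψ : W →ₗ[ℂ] (K → ℂ) :=
      { toFun := fun μ k => contractZ (μ : Fin 5 → Fin 5 → ℂ) i i' k.1
        map_add' := by
          intro μ ν; funext k
          have h := congrFun (congrFun (congrFun (cZ.map_add (μ : Fin 5 → Fin 5 → ℂ) ν) i) i') k.1
          simp only [cZ_apply, Pi.add_apply] at h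
          simpa only [Submodule.coe_add, Pi.add_apply] using h
        map_smul' := by
          intro r μ; funext k
          have h := congrFun (congrFun (congrFun (cZ.map_smul r (μ : Fin 5 → Fin 5 → ℂ)) i) i') k.1
          simp only [cZ_apply, Pi.smul_apply, smul_eq_mul] at h
          simpa only [Submodule.coe_smul, Pi.smul_apply, smul_eq_mul, RingHom.id_apply] using h }
    have hΨ : ∀ (μ : W) (k : K), Ψ μ k = contractZ (μ : Fin 5 → Fin 5 → ℂ) i i' k.1 := fun _ _ => rfl
    have hΨinj : Function.Injective Ψ := by
      rw [injective_iff_map_eq_zero]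
      intro μ hμ0
      obtain ⟨a', hT, hL⟩ := hstruct μ.1 μ.2
      have hai : a' i = 0 := hL i i' hui
      have hai' : a' i' = 0 := hL i' i (by rw [hu]; exact hui)
      have haj : a' j = 0 := hL j j' huj
      have hcoord : ∀ k, contractZ (μ : Fin 5 → Fin 5 → ℂ) i i' k = u i i' * a' k := by
        intro k; rw [hT, hai, hai']; ring
      have ha : ∀ k, a' k = 0 := by
        intro k
        by_cases hki : k = i
        · rw [hki]; exact hai
        by_cases hkj : k = j
        · rw [hkj]; exact haj
        have h0 : Ψ μ ⟨k, hki, hkj⟩ = 0 := by rw [hμ0]; rfl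
        rw [hΨ, hcoord] at h0
        rcases mul_eq_zero.mp h0 with h | h
        · exact absurd h hui
        · exact h
      exact Subtype.ext (contractZ_eq_zero_of_structure u μ.1 a' hT ha (hWs μ.1 μ.2) (hWd μ.1 μ.2))
    have hcard : Fintype.card K = 3 := by
      have e1 : Fintype.card K = (Finset.univ.filter (fun k : Fin 5 => k ≠ i ∧ k ≠ j)).card :=
        Fintype.card_subtype _
      have hset : Finset.univ.filter (fun k : Fin 5 => k ≠ i ∧ k ≠ j) = (Finset.univ.erase i).erase j := by
        ext k; simp [Finset.mem_erase, and_comm]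
      rw [e1, hset, Finset.card_erase_of_mem (Finset.mem_erase.mpr ⟨hij.symm, Finset.mem_univ j⟩),
        Finset.card_erase_of_mem (Finset.mem_univ i)]
      simp
    have hle := LinearMap.finrank_le_finrank_of_injective hΨinj
    rw [Module.finrank_fintype_fun_eq_card, hcard] at hle
    exact hle
  · push Not at htwo
    apply hbot
    intro μ hμ
    obtain ⟨a', hT, hL⟩ := hstruct μ hμ
    by_cases hu0 : ∀ p q, u p q = 0
    · refine hub_injective μ (hWs μ hμ) (hWd μ hμ) fun p q => Finset.sum_eq_zero fun r _ => ?_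
      rw [hT, hu0, hu0, hu0]; ring
    · push Not at hu0
      obtain ⟨i, i', hui⟩ := hu0
      have hsame : ∀ j j', u j j' ≠ 0 → j = i := by
        intro j j' huj
        by_contra hji
        exact huj (htwo i i' j j' (fun h => hji h.symm) hui)
      have hi' : i' = i := hsame i' i (by rw [hu]; exact hui)
      have hii : u i i ≠ 0 := by rw [hi'] at hui; exact hui
      have hai : a' i = 0 := hL i i' hui
      have ha : ∀ r, a' r = 0 := by
        intro r
        by_cases hri : r = i
        · rw [hri]; exact hai
        have huir : u i r = 0 := by
          by_contra h
          exact hri (hsame r i (by rw [hu]; exact h))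
        have h0 := contractZ_rep12 μ i r
        rw [hT, hai, huir] at h0
        have : u i i * a' r = 0 := by linear_combination h0
        rcases mul_eq_zero.mp this with h | h
        · exact absurd h hii
        · exact h
      exact contractZ_eq_zero_of_structure u μ a' hT ha (hWs μ hμ) (hWd μ hμ)

end LaplaceFiveSeparatedCapture

end Summit.ValiantsHypothesis.ValiantsHypothesis.Theorems.RigidityForcesSymmetryRankRigidMinimalRepr
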